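import Literature.AlgebraicGeometry.Frobenioids.BiratUnitsEquivalence
import Literature.AlgebraicGeometry.Frobenioids.BiratLocalization
import Literature.AlgebraicGeometry.Frobenioids.PreFrobenioidEquivalenceTransport
import Literature.AlgebraicGeometry.Frobenioids.ModelFrobenioidComparison
import HarnessLib

/-!
# Frobenioids I, Corollary 4.10 (units clause) for the structure induced along an equivalence: the rational
# function monoid `(B, Div_B)` is transported

Mochizuki, *The geometry of Frobenioids I: the general theory*, Kyushu J. Math. **62** (2008) 293–400, §4,
Cor. 4.10, kurims text p. 90 [cite: MochizukiFrdI2008, Cor. 4.10 p.90]: "Then `Ψ` induces a 1-unique functor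
`Ψ^birat : C₁^birat → C₂^birat` …"; Prop. 4.4 (ii) p. 83 (the rational function monoid `A ↦ O^×(A^birat)`);
Thm. 5.2 (ii) p. 101: "there is a natural isomorphism of functors between the functor "`O^×(−)`" on `D` associated
to the Frobenioid `C^birat` […] and the functor `B`; this isomorphism is compatible with the homomorphisms
`O^×(−) → Φ^gp` […], `Div_B : B → Φ^gp`" — typed by abc-iut-L1-t2 as the structure
`PreFrobenioid.RationalFunctionMonoidStr F hF B DivB` of `ModelFrobenioidComparison.lean` (our name, not print's).

What this file does (our words, proof-only, 0 `def`s).  For an equivalence of categories `e : C' ≌ C` and a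
Frobenioid `F : C → F_Φ`, the INDUCED structure `e.functor ⋙ F` on `C'` is a Frobenioid (abc-iut-L6-t6,
`IsFrobenioid.comp_equivalence`); this file proves that a rational-function-monoid structure `(B, Div_B)` for `F`
induces one for `e.functor ⋙ F` — `RationalFunctionMonoidStr.nonempty_precomp_equivalence` — by composing the
objectwise isomorphisms `B(Base e(A)) ≅ O^×(e(A)^birat)` with the inverse of abc-iut-L1's explicit
`Ψ^birat : O^×(A^birat) ⥲ O^×(e(A)^birat)` (`BiratUnits.equivOfEquiv`, `BiratUnitsEquivalence.lean`):
* the four hypotheses of `equivOfEquiv` for `Ψ = e`, `F₁ = e ⋙ F`, `F₂ = F` (`e` and `e⁻¹` preserve co-angular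
  pre-steps and base-equivalent pairs) hold by L6-t6's `isCoAngularPreStep_equivalence_iff` and (co)unit
  naturality (`isCoAngularPreStep_map_of_precomp`, `…_inverse_map_of_precomp`, `baseEquivalent_…`);
* the divisor map is preserved on the nose (`BiratUnits.divHom_mapEquiv_precomp`; `invDiv_precomp` is `rfl`);
* the naturality relation "`ψ ∘ u = v ∘ ψ` in `C^birat`" (`BiratUnits.Intertwines`, Prop. 2.2 (ii)) is REFLECTED
  by `Ψ^birat` (`BiratUnits.intertwines_of_intertwines_mapEquiv`): its witnessing square is first moved to the
  given representing fractions (`Intertwines.exists_data_of_rel` — directedness of co-angular pre-steps,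
  Def. 1.3 (iii)(d), `exists_common_refinement`, plus the birational squares of Prop. 1.11 (vii),
  `hasBiratSquares_of_isFrobenioid`) and then pulled back along `e⁻¹` and the unit `e⁻¹e ≅ 1`.
Consumer: [IUTchI] Ex 5.1 (iv) for `†ℱ^⊛` itself (`Literature/IUT/HodgeTheaters/GlobalFrobenioidsBiratUnits.lean`,
abc-iut-w4-d050): `†ℱ^⊛` is "any category equivalent to" the model Frobenioid `ℱ^⊛(†𝒟^⊚)`.  No statement of the
paper is restated or strengthened; nothing here is specific to the abc programme.
-/

namespace Literature.AlgebraicGeometry.Frobenioids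

open CategoryTheory Opposite

universe w v v' v'' u u' u''

namespace PreFrobenioid

variable {D : Type u} [Category.{v} D] {Φ : Dᵒᵖ ⥤ CommMonCat.{w}}
  {C : Type u'} [Category.{v'} C] {C' : Type u''} [Category.{v''} C']
  {F : C ⥤ ElemFrobenioid Φ}

/-! ### The hypotheses of [FrdI] Cor 4.10 (`BiratUnits.equivOfEquiv`) for `Ψ = e`, `F₁ = e ⋙ F`, `F₂ = F` -/

section Hypotheses

variable (e : C' ≌ C)

/-- `e` carries co-angular pre-steps of the induced structure `e ⋙ F` to co-angular pre-steps of `F`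
(L6-t6's `isCoAngularPreStep_equivalence_iff`). [cite: MochizukiFrdI2008, Def. 1.3(iii) p.25] -/
theorem isCoAngularPreStep_map_of_precomp (hP : IsPreFrobenioid Φ F) ⦃A B : C'⦄ (f : A ⟶ B)
    (hf : IsCoAngularPreStep (e.functor ⋙ F) f) : IsCoAngularPreStep F (e.functor.map f) :=
  (isCoAngularPreStep_equivalence_iff e hP f).mp hf

/-- `e` carries base-equivalent pairs of `e ⋙ F` to base-equivalent pairs of `F` (literally the same equation).
[cite: MochizukiFrdI2008, Def. 1.2(ii) p.22] -/
theorem baseEquivalent_map_of_precomp ⦃A B : C'⦄ (f g : A ⟶ B) (h : BaseEquivalent (e.functor ⋙ F) f g) :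
    BaseEquivalent F (e.functor.map f) (e.functor.map g) :=
  h

/-- `e⁻¹` carries co-angular pre-steps of `F` to co-angular pre-steps of `e ⋙ F`: `e(e⁻¹ f) = c ≫ f ≫ c⁻¹` for
the counit `c`, and co-angular pre-steps are stable under composition with isomorphisms.
[cite: MochizukiFrdI2008, Def. 1.3(iii) p.25] -/
theorem isCoAngularPreStep_inverse_map_of_precomp (hP : IsPreFrobenioid Φ F) ⦃A B : C⦄ (f : A ⟶ B)
    (hf : IsCoAngularPreStep F f) : IsCoAngularPreStep (e.functor ⋙ F) (e.inverse.map f) := by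
  rw [isCoAngularPreStep_equivalence_iff e hP, e.fun_inv_map]
  have h : IsCoAngularPreStep F ((e.counitIso.app A).hom ≫ f ≫ (e.counitIso.app B).inv) :=
    (hf.comp_iso (e.counitIso.app B).inv).iso_comp (e.counitIso.app A).hom
  exact h

/-- `e⁻¹` carries base-equivalent pairs of `F` to base-equivalent pairs of `e ⋙ F` (`Base` is functorial,
`e(e⁻¹ f) = c ≫ f ≫ c⁻¹`). [cite: MochizukiFrdI2008, Def. 1.2(ii) p.22] -/
theorem baseEquivalent_inverse_map_of_precomp ⦃A B : C⦄ (f g : A ⟶ B) (h : BaseEquivalent F f g) :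
    BaseEquivalent (e.functor ⋙ F) (e.inverse.map f) (e.inverse.map g) := by
  have h' : Base F f = Base F g := h
  obtain ⟨α⟩ : Nonempty (e.inverse ⋙ e.functor ⋙ baseFunctor F ≅ baseFunctor F) :=
    ⟨Functor.isoWhiskerRight e.counitIso (baseFunctor F)⟩
  have nat : ∀ k : A ⟶ B,
      Base F (e.functor.map (e.inverse.map k)) = α.hom.app A ≫ Base F k ≫ α.inv.app B := fun k =>
    (NatIso.naturality_2 α k).symm
  change Base F (e.functor.map (e.inverse.map f)) = Base F (e.functor.map (e.inverse.map g))
  rw [nat, nat, h']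

end Hypotheses

/-! ### `Intertwines` ("`ψ ∘ u = v ∘ ψ` in `C^birat`") is independent of the representing fractions -/

namespace BiratUnits

variable (hF : IsFrobenioid F)
include hF

/-- The witnesses `(E, κ, l)` of "`ψ ∘ [p] = [q] ∘ ψ` in `C^birat`" can be moved to any refinement-related
fractions `p ∼ p'`, `q ∼ q'`: refine `κ` against the refinement of `p` (directedness of co-angular pre-steps,
[FrdI] Def 1.3 (iii)(d)), then complete the square against the refinement of `q` ([FrdI] Prop 1.11 (vii),
`hasBiratSquares_of_isFrobenioid`). [cite: MochizukiFrdI2008, Prop. 4.4(i) p.84] -/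
theorem Intertwines.exists_data_of_rel {A A' : C} (ψ : A ⟶ A') {p p' : RatFrac F A} {q q' : RatFrac F A'}
    (hp : RatFrac.Rel p p') (hq : RatFrac.Rel q q') {E : C} (κ : E ⟶ p.src) (l : E ⟶ q.src)
    (hκ : IsCoAngularPreStep F κ) (h₁ : l ≫ q.den = κ ≫ p.den ≫ ψ) (h₂ : l ≫ q.num = κ ≫ p.num ≫ ψ) :
    ∃ (E' : C) (κ' : E' ⟶ p'.src) (l' : E' ⟶ q'.src), IsCoAngularPreStep F κ' ∧
      l' ≫ q'.den = κ' ≫ p'.den ≫ ψ ∧ l' ≫ q'.num = κ' ≫ p'.num ≫ ψ := by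
  obtain ⟨R, r, r', hr, hr', hr₁, hr₂⟩ := hp
  obtain ⟨S, s, s', hs, hs', hs₁, hs₂⟩ := hq
  obtain ⟨E₁, a, b, ha, hb, hab⟩ := exists_common_refinement hF κ r hκ hr
  obtain ⟨E₂, a₂, n, ha₂, hsq⟩ := hasBiratSquares_of_isFrobenioid hF (a ≫ l) s hs
  refine ⟨E₂, a₂ ≫ b ≫ r', n ≫ s', ha₂.comp hF (hb.comp hF hr'), ?_, ?_⟩
  · calc (n ≫ s') ≫ q'.den = n ≫ (s' ≫ q'.den) := Category.assoc _ _ _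
      _ = n ≫ (s ≫ q.den) := by rw [hs₁]
      _ = (n ≫ s) ≫ q.den := (Category.assoc _ _ _).symm
      _ = (a₂ ≫ a ≫ l) ≫ q.den := by rw [hsq]
      _ = a₂ ≫ a ≫ (l ≫ q.den) := by simp only [Category.assoc]
      _ = a₂ ≫ (a ≫ κ) ≫ p.den ≫ ψ := by rw [h₁]; simp only [Category.assoc]
      _ = a₂ ≫ (b ≫ r) ≫ p.den ≫ ψ := by rw [hab]
      _ = a₂ ≫ b ≫ (r ≫ p.den) ≫ ψ := by simp only [Category.assoc]
      _ = (a₂ ≫ b ≫ r') ≫ p'.den ≫ ψ := by rw [hr₁]; simp only [Category.assoc]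
  · calc (n ≫ s') ≫ q'.num = n ≫ (s' ≫ q'.num) := Category.assoc _ _ _
      _ = n ≫ (s ≫ q.num) := by rw [hs₂]
      _ = (n ≫ s) ≫ q.num := (Category.assoc _ _ _).symm
      _ = (a₂ ≫ a ≫ l) ≫ q.num := by rw [hsq]
      _ = a₂ ≫ a ≫ (l ≫ q.num) := by simp only [Category.assoc]
      _ = a₂ ≫ (a ≫ κ) ≫ p.num ≫ ψ := by rw [h₂]; simp only [Category.assoc]
      _ = a₂ ≫ (b ≫ r) ≫ p.num ≫ ψ := by rw [hab]
      _ = a₂ ≫ b ≫ (r ≫ p.num) ≫ ψ := by simp only [Category.assoc]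
      _ = (a₂ ≫ b ≫ r') ≫ p'.num ≫ ψ := by rw [hr₂]; simp only [Category.assoc]

/-- `Intertwines ψ u v` admits witnesses starting from ANY fractions representing `u` and `v`.
[cite: MochizukiFrdI2008, Prop. 4.4(i) p.84] -/
theorem Intertwines.exists_data {A A' : C} {ψ : A ⟶ A'} {u : BiratUnits F hF A} {v : BiratUnits F hF A'}
    (h : Intertwines hF ψ u v) (p' : RatFrac F A) (q' : RatFrac F A') (hp' : mk hF p' = u)
    (hq' : mk hF q' = v) :
    ∃ (E' : C) (κ' : E' ⟶ p'.src) (l' : E' ⟶ q'.src), IsCoAngularPreStep F κ' ∧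
      l' ≫ q'.den = κ' ≫ p'.den ≫ ψ ∧ l' ≫ q'.num = κ' ≫ p'.num ≫ ψ := by
  obtain ⟨p, q, E, κ, l, hpu, hqv, hκ, h₁, h₂⟩ := h
  exact Intertwines.exists_data_of_rel hF ψ (mk_eq_mk_iff.mp (hpu.trans hp'.symm))
    (mk_eq_mk_iff.mp (hqv.trans hq'.symm)) κ l hκ h₁ h₂

end BiratUnits

/-! ### Transport of the rational function monoid along an equivalence ([FrdI] Cor 4.10, units clause) -/

section Transport

variable (e : C' ≌ C) (hF : IsFrobenioid F) (hF' : IsFrobenioid (e.functor ⋙ F))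

namespace BiratUnits

/-- Moving an arrow into `e(X)` back along `e⁻¹` and the unit commutes with composition on the right
(naturality of the unit). [cite: MochizukiFrdI2008, Cor. 4.10 p.90] -/
theorem inverse_map_comp_unitInv_comp {X Y : C'} (δ : X ⟶ Y) {E : C} (ε : E ⟶ e.functor.obj X) :
    (e.inverse.map ε ≫ e.unitInv.app X) ≫ δ = e.inverse.map (ε ≫ e.functor.map δ) ≫ e.unitInv.app Y := by
  have nat : (e.inverse.map (e.functor.map δ) ≫ e.unitInv.app Y : _ ⟶ Y) = e.unitInv.app X ≫ δ :=
    e.unitInv.naturality δ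
  calc (e.inverse.map ε ≫ e.unitInv.app X) ≫ δ
      = e.inverse.map ε ≫ (e.unitInv.app X ≫ δ) := Category.assoc _ _ _
    _ = e.inverse.map ε ≫ (e.inverse.map (e.functor.map δ) ≫ e.unitInv.app Y) :=
        congrArg (fun t => e.inverse.map ε ≫ t) nat.symm
    _ = (e.inverse.map ε ≫ e.inverse.map (e.functor.map δ)) ≫ e.unitInv.app Y := (Category.assoc _ _ _).symm
    _ = e.inverse.map (ε ≫ e.functor.map δ) ≫ e.unitInv.app Y :=
        congrArg (fun t => t ≫ e.unitInv.app Y) (e.inverse.map_comp ε (e.functor.map δ)).symm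

variable
  (hΨ : ∀ ⦃A B : C'⦄ (f : A ⟶ B), IsCoAngularPreStep (e.functor ⋙ F) f → IsCoAngularPreStep F (e.functor.map f))
  (hb : ∀ ⦃A B : C'⦄ (f g : A ⟶ B), BaseEquivalent (e.functor ⋙ F) f g →
    BaseEquivalent F (e.functor.map f) (e.functor.map g))

include hF hF' in
/-- **`Ψ^birat` reflects "`ψ ∘ u = v ∘ ψ`"** for `Ψ = e`: if the images under `e` of `u ∈ 𝒪^×(A^birat)`,
`v ∈ 𝒪^×(A'^birat)` (structure `e ⋙ F`) are intertwined by `e(ψ)` in `C^birat`, then `u`, `v` are intertwined by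
`ψ` in `C'^birat` — move the witnessing square back along `e⁻¹` and the unit `e⁻¹e ≅ 1`.
[cite: MochizukiFrdI2008, Cor. 4.10 p.90] -/
theorem intertwines_of_intertwines_mapEquiv {A A' : C'} (ψ : A ⟶ A') (u : BiratUnits (e.functor ⋙ F) hF' A)
    (v : BiratUnits (e.functor ⋙ F) hF' A')
    (h : Intertwines hF (e.functor.map ψ) (mapEquiv e hΨ hb hF' hF A u) (mapEquiv e hΨ hb hF' hF A' v)) :
    Intertwines hF' ψ u v := by
  obtain ⟨p₀, rfl⟩ := mk_surjective u
  obtain ⟨q₀, rfl⟩ := mk_surjective v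
  rw [mapEquiv_mk, mapEquiv_mk] at h
  obtain ⟨Et, κt, lt, hκt, h₁, h₂⟩ := Intertwines.exists_data hF h _ _ rfl rfl
  have hκt' : IsCoAngularPreStep F (κt : Et ⟶ e.functor.obj p₀.src) := hκt
  have h₁' : lt ≫ e.functor.map q₀.den = κt ≫ e.functor.map (p₀.den ≫ ψ) := by
    rw [Functor.map_comp]; exact h₁
  have h₂' : lt ≫ e.functor.map q₀.num = κt ≫ e.functor.map (p₀.num ≫ ψ) := by
    rw [Functor.map_comp]; exact h₂
  have hu : ∀ X : C', IsCoAngularPreStep (e.functor ⋙ F) (e.unitInv.app X) := fun X =>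
    hF'.isCoAngularPreStep_of_isIso _
  refine ⟨p₀, q₀, e.inverse.obj Et, e.inverse.map κt ≫ e.unitInv.app p₀.src,
    e.inverse.map lt ≫ e.unitInv.app q₀.src, rfl, rfl,
    (isCoAngularPreStep_inverse_map_of_precomp e hF.isPreFrobenioid _ hκt').comp hF' (hu _), ?_, ?_⟩
  · exact (inverse_map_comp_unitInv_comp e q₀.den lt).trans
      ((congrArg (fun t => e.inverse.map t ≫ e.unitInv.app A') h₁').trans
        (inverse_map_comp_unitInv_comp e (p₀.den ≫ ψ) κt).symm)
  · exact (inverse_map_comp_unitInv_comp e q₀.num lt).trans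
      ((congrArg (fun t => e.inverse.map t ≫ e.unitInv.app A') h₂').trans
        (inverse_map_comp_unitInv_comp e (p₀.num ≫ ψ) κt).symm)

include hF hF' in
/-- `Ψ^birat` for `Ψ = e` preserves the divisor of a rational function ON THE NOSE: the structure `e ⋙ F` reads
`Base`, `Div`, `deg_Fr` through `e` (`invDiv_precomp`). [cite: MochizukiFrdI2008, Cor. 4.10 p.90] -/
theorem divHom_mapEquiv_precomp {A : C'} (x : BiratUnits (e.functor ⋙ F) hF' A) :
    divHom hF (e.functor.obj A) (mapEquiv e hΨ hb hF' hF A x) = divHom hF' A x := by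
  obtain ⟨p, rfl⟩ := mk_surjective x
  rw [mapEquiv_mk, divHom_mk, divHom_mk]
  rfl

variable
  (hΨ' : ∀ ⦃A B : C⦄ (f : A ⟶ B), IsCoAngularPreStep F f → IsCoAngularPreStep (e.functor ⋙ F) (e.inverse.map f))
  (hb' : ∀ ⦃A B : C⦄ (f g : A ⟶ B), BaseEquivalent F f g →
    BaseEquivalent (e.functor ⋙ F) (e.inverse.map f) (e.inverse.map g))

include hF hF' in
/-- `Ψ^birat ∘ (Ψ^birat)⁻¹ = id` on `𝒪^×(e(A)^birat)`. [cite: MochizukiFrdI2008, Cor. 4.10 p.90] -/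
theorem mapEquiv_equivOfEquiv_symm_apply (A : C') (y : BiratUnits F hF (e.functor.obj A)) :
    mapEquiv e hΨ hb hF' hF A ((equivOfEquiv e hΨ hb hF' hF hΨ' hb' A).symm y) = y :=
  (equivOfEquiv e hΨ hb hF' hF hΨ' hb' A).apply_symm_apply y

include hF hF' in
/-- The divisor map of `𝒪^×(A^birat)` (structure `e ⋙ F`) is that of `𝒪^×(e(A)^birat)` through `(Ψ^birat)⁻¹`.
[cite: MochizukiFrdI2008, Cor. 4.10 p.90] -/
theorem divHom_equivOfEquiv_symm_apply (A : C') (y : BiratUnits F hF (e.functor.obj A)) :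
    divHom hF' A ((equivOfEquiv e hΨ hb hF' hF hΨ' hb' A).symm y) = divHom hF (e.functor.obj A) y := by
  rw [← divHom_mapEquiv_precomp e hF hF' hΨ hb, mapEquiv_equivOfEquiv_symm_apply]

include hF hF' in
/-- Naturality transported: if `(B, Div_B)` is the rational function monoid of `F` (`S`), then along a morphism
`ψ` of `C'` linear for `e ⋙ F` the elements `(Ψ^birat)⁻¹(S.iso (B(Base e ψ) b'))` and `(Ψ^birat)⁻¹(S.iso b')` are
intertwined by `ψ` ([FrdI] Prop 2.2 (ii) for the induced structure). [cite: MochizukiFrdI2008, Cor. 4.10 p.90] -/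
theorem intertwines_equivOfEquiv_symm_iso {B : Dᵒᵖ ⥤ CommMonCat.{w}} {DivB : B ⟶ monoidGp Φ}
    (S : RationalFunctionMonoidStr F hF B DivB) {A A' : C'} (ψ : A ⟶ A') (hψ : IsLinear F (e.functor.map ψ))
    (b' : B.obj (op (baseObj F (e.functor.obj A')))) :
    Intertwines hF' ψ
      ((equivOfEquiv e hΨ hb hF' hF hΨ' hb' A).symm
        (S.iso (e.functor.obj A) ((B.map (Base F (e.functor.map ψ)).op).hom b')))
      ((equivOfEquiv e hΨ hb hF' hF hΨ' hb' A').symm (S.iso (e.functor.obj A') b')) := by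
  apply intertwines_of_intertwines_mapEquiv e hF hF' hΨ hb ψ
  rw [mapEquiv_equivOfEquiv_symm_apply, mapEquiv_equivOfEquiv_symm_apply]
  exact S.natural (e.functor.map ψ) hψ b'

end BiratUnits

/-- **[FrdI] Cor 4.10 (units clause) for the induced structure along an equivalence: the rational function
monoid is transported.**  For an equivalence `e : C' ≌ C`, a Frobenioid `F : C → F_Φ` and a monoid `B` on the
base with `Div_B : B → Φ^gp` that IS the rational function monoid of `F` (`RationalFunctionMonoidStr`: objectwise
`B(Base A) ≅ 𝒪^×(A^birat)` compatible with divisors, natural along linear morphisms), `(B, Div_B)` is ALSO the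
rational function monoid of the induced Frobenioid structure `e.functor ⋙ F` on `C'`: compose with the inverse of
`Ψ^birat : 𝒪^×(A^birat) ⥲ 𝒪^×(e(A)^birat)` (`BiratUnits.equivOfEquiv`). [cite: MochizukiFrdI2008, Cor. 4.10 p.90] -/
theorem RationalFunctionMonoidStr.nonempty_precomp_equivalence {B : Dᵒᵖ ⥤ CommMonCat.{w}}
    {DivB : B ⟶ monoidGp Φ} (S : RationalFunctionMonoidStr F hF B DivB) :
    Nonempty (RationalFunctionMonoidStr (e.functor ⋙ F) hF' B DivB) := by
  have hP : IsPreFrobenioid Φ F := hF.isPreFrobenioid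
  refine ⟨{ iso := fun A => (S.iso (e.functor.obj A)).trans
              (BiratUnits.equivOfEquiv e (isCoAngularPreStep_map_of_precomp e hP)
                (baseEquivalent_map_of_precomp e) hF' hF (isCoAngularPreStep_inverse_map_of_precomp e hP)
                (baseEquivalent_inverse_map_of_precomp e) A).symm
            div_iso := fun A b =>
              (BiratUnits.divHom_equivOfEquiv_symm_apply e hF hF' (isCoAngularPreStep_map_of_precomp e hP)
                (baseEquivalent_map_of_precomp e) (isCoAngularPreStep_inverse_map_of_precomp e hP)
                (baseEquivalent_inverse_map_of_precomp e) A (S.iso (e.functor.obj A) b)).trans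
                (S.div_iso (e.functor.obj A) b)
            natural := fun A A' ψ hψ b' =>
              BiratUnits.intertwines_equivOfEquiv_symm_iso e hF hF' (isCoAngularPreStep_map_of_precomp e hP)
                (baseEquivalent_map_of_precomp e) (isCoAngularPreStep_inverse_map_of_precomp e hP)
                (baseEquivalent_inverse_map_of_precomp e) S ψ hψ b' }⟩

end Transport

end PreFrobenioid

end Literature.AlgebraicGeometry.Frobenioids
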